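import Literature.AnabelianGeometry.Anabelioids.OuterActionOfEquivalence
import HarnessLib

/-!
# The outer action of an automorphism of a connected anabelioid: 2-cell invariance

Mochizuki, [GeoAn] Def. 1.1.2 (ii) p. 10 / Rmk. 1.1.2.1 (morphisms of anabelioids are exact functors
"considered up to isomorphism"), and [SemiAnbd] Def. 5.1 (i)(c) p. 62 ("the resulting outer
homomorphism `H → Out(π̂₁(𝔾_v))`") [cite: MochizukiSemiAnbd2006, Def 5.1 (i)(c) p.62].  Continuation of
`OuterActionOfEquivalence.lean` (`outOfEquivalence F P : TopOut (Aut F)`):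

* `pi1Map_conjAut_isoWhiskerRight`, `contAutOfPath_congr`, **`outOfEquivalence_congr`** — the outer
  automorphism of `π₁(X, F)` induced by a self-equivalence depends only on its 2-ISOMORPHISM CLASS
  (`P ≅ P'` ⇒ `out(P) = out(P')`): representative-independence for automorphisms of anabelioids taken
  up to 2-isomorphism (the 1-category `SgAQuot` of the abc-iut L3 container).

(The transport into the PROFINITE `Out_top(π₁(X, F)) = CongrOut (Aut F)` of
`Literature/Topology/Algebra/ProfiniteOutCongruence.lean` is `CongrOut.equivTopOut.symm`; a packaged
form is filed separately.)  Mathlib-level; nothing disputed is involved.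
-/

namespace Literature.AnabelianGeometry.Anabelioids

open CategoryTheory CategoryTheory.Functor CategoryTheory.PreGaloisCategory
open Literature.AnabelianGeometry.EtaleTheta (contMulAut mem_contMulAut TopOut)

universe u₁ u₂

variable {X : Type u₁} [Category.{u₂} X] [GaloisCategory X] (F : X ⥤ FintypeCat.{u₂}) [FiberFunctor F]
  {P P' : X ⥤ X} [P.IsEquivalence] [P'.IsEquivalence]

/-! ## 2-cell invariance -/

omit [GaloisCategory X] [FiberFunctor F] [P.IsEquivalence] [P'.IsEquivalence] in
/-- Naturality of `σ ∈ Aut F` along a 2-cell `η : P ≅ P'`: conjugating `P^*(σ)` by `η ▷ F` gives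
`P'^*(σ)`. [cite: MochizukiGeoAn2004, Def. 1.1.2(ii) p.10] -/
theorem pi1Map_conjAut_isoWhiskerRight (η : P ≅ P') (σ : Aut F) :
    (isoWhiskerRight η F).conjAut (pi1Map P F σ) = pi1Map P' F σ := by
  refine Iso.ext (NatTrans.ext (funext fun B => ?_))
  simp only [Iso.conjAut_hom, Iso.conj_apply, isoWhiskerRight_inv, isoWhiskerRight_hom]
  rw [NatTrans.comp_app, NatTrans.comp_app, whiskerRight_app, whiskerRight_app, pi1Map_hom_app]
  change F.map (η.inv.app B) ≫ σ.hom.app (P.obj B) ≫ F.map (η.hom.app B) = σ.hom.app (P'.obj B)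
  have hnat : F.map (η.hom.app B) ≫ σ.hom.app (P'.obj B) = σ.hom.app (P.obj B) ≫ F.map (η.hom.app B) :=
    σ.hom.naturality (η.hom.app B)
  rw [← hnat, ← Category.assoc, ← F.map_comp, Iso.inv_hom_id_app, F.map_id, Category.id_comp]

variable (P P') in
/-- **2-cell invariance at the level of paths**: transporting the path along `η : P ≅ P'` does not
change the automorphism of `π₁(X, F)`. [cite: MochizukiGeoAn2004, Def. 1.1.2(ii) p.10] -/
theorem contAutOfPath_congr (η : P ≅ P') (e : P ⋙ F ≅ F) :
    contAutOfPath F P' ((isoWhiskerRight η F).symm ≪≫ e) = contAutOfPath F P e := by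
  apply Subtype.ext
  apply MulEquiv.ext
  intro σ
  rw [contAutOfPath_apply, contAutOfPath_apply, Iso.trans_conjAut, ← pi1Map_conjAut_isoWhiskerRight F η σ,
    conjAut_symm_apply_conjAut]

variable (P P') in
/-- **`out(P)` depends only on the 2-isomorphism class of `P`** ([GeoAn] Rmk. 1.1.2.1: morphisms of
anabelioids up to isomorphism of functors). [cite: MochizukiGeoAn2004, Def. 1.1.2(ii) p.10] -/
theorem outOfEquivalence_congr (η : P ≅ P') : outOfEquivalence F P = outOfEquivalence F P' := by
  obtain ⟨e⟩ := nonempty_path F P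
  rw [outOfEquivalence_eq_mk F P e, outOfEquivalence_eq_mk F P' ((isoWhiskerRight η F).symm ≪≫ e),
    contAutOfPath_congr]

end Literature.AnabelianGeometry.Anabelioids
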